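import Literature.MathematicalPhysics.KineticTheory.LangevinChainGeneratorStep
import Literature.MathematicalPhysics.KineticTheory.LangevinChainExpBound
import Literature.MathematicalPhysics.KineticTheory.LangevinChainHormander
import Mathlib.MeasureTheory.Integral.IntervalIntegral.FundThmCalculus
import Mathlib.Probability.Kernel.Composition.IntegralCompProd
import Mathlib.Probability.Kernel.Composition.MeasureComp
import HarnessLib

/-!
# The transition semigroup of the pinned chain: Dynkin's identity, and CEHR Theorem 2.13 up to H2 and Hörmander

Trunk T-KINETIC (Literature/MathematicalPhysics/KineticTheory). Sixth decomposition step for the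
named fact `CuneoEckmannHairerReyBellet2018_pinnedChain` (provefact unit). Cuneo–Eckmann–Hairer–
Rey-Bellet 2018, §3 p. 7: "the process admits strong solutions that are continuous and defined for
all `t ≥ 0` … the strong Markov property is satisfied … The solutions to (3.1) form a Markov process
whose generator `L` is given by (3.2)"; p. 9: "the process is Feller". This file completes the
CONSTRUCTION of that Markov semigroup for the pinned chain inside the tree:

* `pinnedChain_dynkin` — **Dynkin's identity `P_t f(z) - f(z) = ∫₀ᵗ P_s(Lf)(z) ds` for `f ∈ C_c^∞`,
  PROVED** for the transition kernels of `LangevinChainKernel.lean`: `s ↦ P_s f(z)` is continuous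
  (dominated convergence along the continuous flow) with the uniform right derivative `P_s(Lf)(z)`
  (Chapman–Kolmogorov + the one-step estimate `pinnedChain_generator_step`), and the fundamental
  theorem of calculus for right derivatives (`intervalIntegral.integral_eq_sub_of_hasDeriv_right_of_le`)
  concludes.
* `pinnedChainSemigroup` — the transition kernels ARE a `LangevinChainSemigroup` (Markov, `P_0 = id`,
  Chapman–Kolmogorov, measurable, Dynkin): the object whose existence `CuneoEckmannHairerReyBellet2018_thm213`
  and `…_lyapunov` package existentially; `continuous_act_pinnedChainSemigroup` (Feller) and
  `lintegral_exp_mul_hamiltonian_pinnedChainSemigroup_le` ((3.4), from `LangevinChainExpBound.lean`).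
* `CuneoEckmannHairerReyBellet2018_H2` — NAMED FACT: CEHR Theorem 5.1 / Remark 5.2 (the Lyapunov
  condition H2 for `e^{θH}`), now stated ABOUT THE CONSTRUCTED KERNELS (no existential packaging).
* `CuneoEckmannHairerReyBellet2018_lyapunov_of_H2`, `CuneoEckmannHairerReyBellet2018_pinnedChain_of_H2_of_hormander`
  — PROVED: the Lyapunov/semigroup fact, and hence (with `LangevinChainHormander.lean`) the
  weak-stationarity fact, follow from H2 and Hörmander's Theorem 1.1.

So after this file the discharge of `CuneoEckmannHairerReyBellet2018_pinnedChain` rests on exactly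
two named facts, both deep theory absent from Mathlib: CEHR Thm 5.1 (H2: the high-energy
dissipation estimate of §5, stochastic analysis of the constructed process) and Hörmander 1967
Thm 1.1 (hypoellipticity).

## References

* N. Cuneo, J.-P. Eckmann, M. Hairer, L. Rey-Bellet, *Non-equilibrium steady states for networks of
  oscillators*, EJP 23 (2018) no. 55 (arXiv:1712.09413): eq. (2.3), §3 eq. (3.2)–(3.4) and p. 7,
  §3.3 (Feller, Prop. 3.7), Thm 5.1 and Remark 5.2. Page numbers refer to the arXiv version.
* E. B. Dynkin, *Markov Processes* I (1965), Ch. I §2 (the identity `T_t f - f = ∫₀ᵗ T_s A f ds`).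
-/

noncomputable section

open MeasureTheory ProbabilityTheory Filter Topology Set Metric
open scoped NNReal ENNReal ContDiff

namespace Literature.MathematicalPhysics.KineticTheory.HeatConduction

open Literature.Probability.Process OscillatorChain

section Dynkin

variable {ω₂ lam β γ : ℝ} (hω : 0 < ω₂) (hl : 0 ≤ lam) (hβ : 0 ≤ β) (hγ : 0 ≤ γ) {N : ℕ} (hN : 0 < N)
  {T_L T_R : ℝ} (hTL : 0 ≤ T_L) (hTR : 0 ≤ T_R)
include hω hl hβ hγ hN hTL hTR

/-- **Dynkin's identity for the transition kernels of the pinned chain**: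
`P_t f(z) - f(z) = ∫₀ᵗ P_s(Lf)(z) ds` for `f ∈ C_c^∞` — the field `dynkin` of the interface
`LangevinChainSemigroup`. Proof: `φ(s) = P_s f(z)` is continuous (dominated convergence along the
continuous flow) and has the RIGHT derivative `P_s(Lf)(z)` at every `s ≥ 0`, uniformly, by the
Chapman–Kolmogorov equation and the uniform one-step estimate `pinnedChain_generator_step`; the
fundamental theorem of calculus for right derivatives concludes.
[cite: CuneoEckmannHairerReyBellet2018, §3 p. 7] -/
theorem pinnedChain_dynkin (f : PhaseSpace N → ℝ) (hf : ContDiff ℝ ∞ f) (hf' : HasCompactSupport f)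
    (t : ℝ≥0) (z : PhaseSpace N) :
    ∫ y, f y ∂((pinnedChain ω₂ lam β γ).transitionKernel N T_L T_R t z) - f z =
      ∫ s in (0 : ℝ)..(t : ℝ), ∫ y, (pinnedChain ω₂ lam β γ).generator N T_L T_R f y
        ∂((pinnedChain ω₂ lam β γ).transitionKernel N T_L T_R s.toNNReal z) := by
  set P := pinnedChain ω₂ lam β γ with hP
  set κ := P.transitionKernel N T_L T_R with hκ
  haveI : ∀ s, IsMarkovKernel (κ s) := fun s => pinnedChain_isMarkovKernel_transitionKernel hω hl hβ hγ N T_L T_R s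
  have hf2 : ContDiff ℝ 2 f := hf.of_le (by norm_cast)
  set Lf := P.generator N T_L T_R f with hLf
  have hLc : Continuous Lf :=
    P.continuous_generator (pinnedChain_contDiff_U ω₂ lam β γ) (pinnedChain_contDiff_V ω₂ lam β γ) N T_L T_R hf2
  obtain ⟨CL, hCL⟩ := P.exists_bound_generator (pinnedChain_contDiff_U ω₂ lam β γ)
    (pinnedChain_contDiff_V ω₂ lam β γ) N T_L T_R hf2 hf'
  obtain ⟨Cf, hCf⟩ : ∃ C, ∀ x, ‖f x‖ ≤ C := hf.continuous.bounded_above_of_compact_support hf'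
  set φ : ℝ → ℝ := fun s => ∫ y, f y ∂(κ s.toNNReal z) with hφ
  set ψ : ℝ → ℝ := fun s => ∫ y, Lf y ∂(κ s.toNNReal z) with hψ
  -- representation through the flow
  have hφ' : φ = fun s => ∫ w, f (P.solMap N T_L T_R (s.toNNReal : ℝ) z (pairPath w)) ∂wienerPair := by
    funext s
    exact pinnedChain_integral_transitionKernel hω hl hβ hγ N T_L T_R _ z hf.continuous.aestronglyMeasurable
  have hψ' : ψ = fun s => ∫ w, Lf (P.solMap N T_L T_R (s.toNNReal : ℝ) z (pairPath w)) ∂wienerPair := by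
    funext s
    exact pinnedChain_integral_transitionKernel hω hl hβ hγ N T_L T_R _ z hLc.aestronglyMeasurable
  -- continuity (dominated convergence along the continuous flow)
  have hflow_cont : ∀ w, Continuous fun s : ℝ => P.solMap N T_L T_R (s.toNNReal : ℝ) z (pairPath w) :=
    fun w => (pinnedChain_continuous_solMap hω hl hβ hγ N T_L T_R z (pairPath w)).comp
      (continuous_subtype_val.comp continuous_real_toNNReal)
  have hflow_meas : ∀ s : ℝ, Measurable fun w => P.solMap N T_L T_R (s.toNNReal : ℝ) z (pairPath w) :=
    fun s => pinnedChain_measurable_solMap_pairPath_right hω hl hβ hγ N T_L T_R _ z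
  have hcontφ : Continuous φ := by
    rw [hφ']
    exact continuous_of_dominated (fun s => (hf.continuous.measurable.comp (hflow_meas s)).aestronglyMeasurable)
      (fun s => Eventually.of_forall fun w => hCf _) (integrable_const Cf)
      (Eventually.of_forall fun w => hf.continuous.comp (hflow_cont w))
  have hcontψ : Continuous ψ := by
    rw [hψ']
    exact continuous_of_dominated (fun s => (hLc.measurable.comp (hflow_meas s)).aestronglyMeasurable)
      (fun s => Eventually.of_forall fun w => hCL _) (integrable_const CL)
      (Eventually.of_forall fun w => hLc.comp (hflow_cont w))
  -- integrability against the kernels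
  have hf_int : ∀ μ : Measure (PhaseSpace N), IsFiniteMeasure μ → Integrable f μ := fun μ _ =>
    (integrable_const Cf).mono' hf.continuous.aestronglyMeasurable (Eventually.of_forall hCf)
  have hLf_int : ∀ μ : Measure (PhaseSpace N), IsFiniteMeasure μ → Integrable Lf μ := fun μ _ =>
    (integrable_const CL).mono' hLc.aestronglyMeasurable (Eventually.of_forall hCL)
  have hPf_meas : ∀ r : ℝ≥0, StronglyMeasurable fun y => ∫ y', f y' ∂(κ r y) := fun r =>
    hf.continuous.stronglyMeasurable.integral_kernel (κ := κ r)
  have hPf_bound : ∀ (r : ℝ≥0) y, ‖∫ y', f y' ∂(κ r y)‖ ≤ Cf := fun r y => by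
    calc ‖∫ y', f y' ∂(κ r y)‖ ≤ Cf * (κ r y).real univ := norm_integral_le_of_norm_le_const (Eventually.of_forall hCf)
      _ = Cf := by simp [probReal_univ]
  -- the right derivative, uniformly in `s ≥ 0`
  have hderiv : ∀ s : ℝ, 0 ≤ s → HasDerivWithinAt φ (ψ s) (Ioi s) s := by
    intro s hs
    rw [hasDerivWithinAt_iff_tendsto, Metric.tendsto_nhdsWithin_nhds]
    intro ε hε
    obtain ⟨h₀, hh₀, hstep⟩ := pinnedChain_generator_step hω hl hβ hγ hN hTL hTR hf2 hf' (half_pos hε)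
    refine ⟨h₀, hh₀, fun x hx hxs => ?_⟩
    have hxpos : 0 < x - s := sub_pos.2 hx
    set hh : ℝ≥0 := ⟨x - s, hxpos.le⟩ with hhh
    have hhco : ((hh : ℝ≥0) : ℝ) = x - s := rfl
    have hxle : x - s ≤ h₀ := by
      rw [dist_eq_norm, Real.norm_eq_abs, abs_of_pos hxpos] at hxs
      exact hxs.le
    have hxnn : x.toNNReal = s.toNNReal + hh := by
      apply NNReal.eq
      rw [NNReal.coe_add, Real.coe_toNNReal _ (hs.trans hx.le), Real.coe_toNNReal _ hs, hhco]
      ring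
    -- Chapman–Kolmogorov: `φ x = ∫ P_hh f d(κ_s z)`
    have e1 : φ x = ∫ y, (∫ y', f y' ∂(κ hh y)) ∂(κ s.toNNReal z) := by
      simp only [hφ]
      rw [hxnn, hκ, pinnedChain_transitionKernel_add hω hl hβ hγ N T_L T_R, ← hκ]
      exact Kernel.integral_comp (hf_int _ inferInstance)
    have hPhf_int : Integrable (fun y => ∫ y', f y' ∂(κ hh y)) (κ s.toNNReal z) :=
      (integrable_const Cf).mono' (hPf_meas hh).aestronglyMeasurable (Eventually.of_forall (hPf_bound hh))
    have key : |φ x - φ s - (x - s) * ψ s| ≤ ε / 2 * (x - s) := by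
      have i1 : Integrable (fun y => (∫ y', f y' ∂(κ hh y)) - f y) (κ s.toNNReal z) :=
        hPhf_int.sub (hf_int _ inferInstance)
      have e2 : φ x - φ s - (x - s) * ψ s =
          ∫ y, ((∫ y', f y' ∂(κ hh y)) - f y - (hh : ℝ) * Lf y) ∂(κ s.toNNReal z) := by
        rw [integral_sub i1 ((hLf_int _ inferInstance).const_mul _), integral_sub hPhf_int (hf_int _ inferInstance),
          integral_const_mul, hhco, e1]
      rw [e2]
      calc |∫ y, ((∫ y', f y' ∂(κ hh y)) - f y - (hh : ℝ) * Lf y) ∂(κ s.toNNReal z)|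
          ≤ ∫ y, |(∫ y', f y' ∂(κ hh y)) - f y - (hh : ℝ) * Lf y| ∂(κ s.toNNReal z) :=
            abs_integral_le_integral_abs
        _ ≤ ∫ y, ε / 2 * (x - s) ∂(κ s.toNNReal z) := by
            refine integral_mono_of_nonneg (Eventually.of_forall fun y => abs_nonneg _) (integrable_const _)
              (Eventually.of_forall fun y => ?_)
            dsimp only
            have := hstep hh (by rw [hhco]; exact hxpos) (by rw [hhco]; exact hxle) y
            rw [← pinnedChain_integral_transitionKernel hω hl hβ hγ N T_L T_R hh y
              hf.continuous.aestronglyMeasurable] at this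
            exact this
        _ = ε / 2 * (x - s) := by simp [probReal_univ]
    rw [dist_eq_norm, Real.norm_eq_abs, sub_zero, abs_mul, abs_inv, Real.norm_eq_abs, Real.norm_eq_abs,
      abs_abs, abs_abs, abs_of_pos hxpos, smul_eq_mul]
    rw [inv_mul_lt_iff₀ hxpos]
    calc |φ x - φ s - (x - s) * ψ s| ≤ ε / 2 * (x - s) := key
      _ < ε * (x - s) := by nlinarith
      _ = (x - s) * ε := mul_comm _ _
  -- the fundamental theorem of calculus for right derivatives
  have hFTC := intervalIntegral.integral_eq_sub_of_hasDeriv_right_of_le t.coe_nonneg hcontφ.continuousOn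
    (fun x hx => hderiv x hx.1.le) (hcontψ.intervalIntegrable _ _)
  have hφ0 : φ 0 = f z := by
    simp only [hφ, Real.toNNReal_zero, hκ]
    rw [pinnedChain_transitionKernel_zero hω hl hβ hγ N T_L T_R, Kernel.id_apply, integral_dirac]
  have hφt : φ t = ∫ y, f y ∂(κ t z) := by simp only [hφ, Real.toNNReal_coe]
  rw [← hφt, ← hφ0, ← hFTC]

end Dynkin


/-! ### The transition semigroup of the pinned chain -/

section Semigroup

variable {ω₂ lam β γ : ℝ} {N : ℕ} {T_L T_R : ℝ}

/-- **The transition semigroup of the pinned chain** (`ω₂ > 0`, `lam, β, γ ≥ 0`, `N ≥ 1`,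
`T_L, T_R ≥ 0`): the transition kernels `P_t(x, ·) = law(Φ_t(x, B))` of the SDE (2.2)
(`OscillatorChain.transitionKernel`, `LangevinChainKernel.lean`) ARE a `LangevinChainSemigroup` —
Markov kernels, `P_0 = id`, Chapman–Kolmogorov, jointly measurable, Dynkin's identity on `C_c^∞`
(`pinnedChain_dynkin`). This is the CONSTRUCTION whose existence the named facts
`CuneoEckmannHairerReyBellet2018_thm213` / `…_lyapunov` package existentially (CEHR (2.3): "We also
introduce the transition kernels `P_t(z, ·)` … `P_t(z, A) = P_z{z_t ∈ A}`"; §3 p. 7: "The solutions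
to (3.1) form a Markov process whose generator `L` is given by (3.2)").
[cite: CuneoEckmannHairerReyBellet2018, eq. (2.3) and §3 eq. (3.2)] -/
def pinnedChainSemigroup (hω : 0 < ω₂) (hl : 0 ≤ lam) (hβ : 0 ≤ β) (hγ : 0 ≤ γ) (hN : 0 < N)
    (hTL : 0 ≤ T_L) (hTR : 0 ≤ T_R) : LangevinChainSemigroup (pinnedChain ω₂ lam β γ) N T_L T_R where
  kernel := (pinnedChain ω₂ lam β γ).transitionKernel N T_L T_R
  isMarkovKernel := pinnedChain_isMarkovKernel_transitionKernel hω hl hβ hγ N T_L T_R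
  kernel_zero := pinnedChain_transitionKernel_zero hω hl hβ hγ N T_L T_R
  kernel_add := pinnedChain_transitionKernel_add hω hl hβ hγ N T_L T_R
  measurable_kernel := pinnedChain_measurable_transitionKernel hω hl hβ hγ N T_L T_R
  dynkin := pinnedChain_dynkin hω hl hβ hγ hN hTL hTR

variable (hω : 0 < ω₂) (hl : 0 ≤ lam) (hβ : 0 ≤ β) (hγ : 0 ≤ γ) (hN : 0 < N) (hTL : 0 ≤ T_L) (hTR : 0 ≤ T_R)
include hω hl hβ hγ hN hTL hTR

/-- The kernels of `pinnedChainSemigroup` are the transition kernels. [folklore] -/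
@[simp] theorem pinnedChainSemigroup_kernel (t : ℝ≥0) :
    (pinnedChainSemigroup hω hl hβ hγ hN hTL hTR).kernel t = (pinnedChain ω₂ lam β γ).transitionKernel N T_L T_R t :=
  rfl

/-- **The Feller property of the transition semigroup** (CEHR p. 9: "the process is Feller").
[cite: CuneoEckmannHairerReyBellet2018, §3.3] -/
theorem continuous_act_pinnedChainSemigroup (t : ℝ≥0) (g : BoundedContinuousFunction (PhaseSpace N) ℝ) :
    Continuous ((pinnedChainSemigroup hω hl hβ hγ hN hTL hTR).act t g) := by
  have h : (pinnedChainSemigroup hω hl hβ hγ hN hTL hTR).act t g =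
      fun x => ∫ y, g y ∂((pinnedChain ω₂ lam β γ).transitionKernel N T_L T_R t x) := rfl
  rw [h]
  exact pinnedChain_continuous_integral_transitionKernel_bcf hω hl hβ hγ N T_L T_R t g

/-- **CEHR (3.4) for the transition semigroup**: `E_z e^{θH(z_t)} ≤ e^{θγ(T_L+T_R)t} e^{θH(z)}` for
`0 < θ < 1/max(T_L, T_R)` (`T_L, T_R > 0`), from `LangevinChainExpBound.lean`.
[cite: CuneoEckmannHairerReyBellet2018, §3 eq. (3.4)] -/
theorem lintegral_exp_mul_hamiltonian_pinnedChainSemigroup_le (hTL' : 0 < T_L) (hTR' : 0 < T_R) {θ : ℝ}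
    (hθ : 0 < θ) (hθ' : θ < 1 / max T_L T_R) (t : ℝ≥0) (z : PhaseSpace N) :
    ∫⁻ y, ENNReal.ofReal (Real.exp (θ * (pinnedChain ω₂ lam β γ).hamiltonian N y))
        ∂((pinnedChain ω₂ lam β γ).transitionKernel N T_L T_R t z) ≤
      ENNReal.ofReal (Real.exp (θ * γ * (T_L + T_R) * t) *
        Real.exp (θ * (pinnedChain ω₂ lam β γ).hamiltonian N z)) :=
  pinnedChain_lintegral_exp_mul_hamiltonian_kernel_le hω hl hβ hγ hN hTL' hTR'
    (pinnedChainSemigroup hω hl hβ hγ hN hTL hTR) hθ hθ' t z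

end Semigroup

/-! ### CEHR Theorem 5.1 / Remark 5.2 (H2) as a named fact about the constructed semigroup -/

/-- NAMED FACT — **Cuneo–Eckmann–Hairer–Rey-Bellet 2018, Theorem 5.1 with Remark 5.2 (the
Lyapunov condition H2 for `V = e^{θH}`)**, for the transition semigroup of the pinned chain
`pinnedChain ω₂ lam β γ` (`ω₂, β, γ > 0`, `lam ≥ 0`, `N ≥ 1`, `T_L, T_R > 0`; Conditions C1, C3–C5
hold: chain with baths at its ends, `U, V` nearly homogeneous of degrees `ℓ_p ∈ {2,4} ≤ ℓ_i = 4`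
with coercive limits, `n = 1`). Printed (§5, "We fix `t_* > 0` and `θ < 1/T_max` with
`T_max = max{T_b : b ∈ B}`"): Theorem 5.1, "Under Conditions C1, C3, C4 and C5, there is a
constant `C₁ > 0` such that for all `z₀` such that `H(z₀)` is large enough, we have
`E_{z₀} e^{θH(z_{t*}) - θH(z₀)} ≤ e^{-C₁H(z₀)}` (5.1)"; Remark 5.2, "By the coercivity of `H`, the
theorem above implies that there exist constants `κ ∈ (0,1)` and `c > 0`, and a compact set `K` such
that `E_z e^{θH(z_{t*})} ≤ κ e^{θH(z)} + c1_K(z)`, which is the usual Lyapunov condition used in H2."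
Vendored in the form of Remark 5.2, ABOUT THE CONSTRUCTED TRANSITION KERNELS
`OscillatorChain.transitionKernel` of the SDE (2.2) (`LangevinChainKernel.lean`,
`pinnedChainSemigroup`; `E_z` = integral against `P_{t*}(z, ·)`, written as a Lebesgue integral of
the nonnegative functional): for every `0 < θ < 1/max(T_L,T_R)` and every `t* > 0` there are
`κ ∈ (0,1)`, `c > 0` and a compact `K` with `E_z e^{θH(z_{t*})} ≤ κ e^{θH(z)} + c 1_K(z)` for all `z`.
The printed proof (§5.1–5.3: dissipation integral, stopping times and the strong Markov property,
the exponential supermartingale bound Lemma 5.5, Prop. 5.3 on high-energy averaging) is stochastic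
analysis not available in the tree; users take `(h : CuneoEckmannHairerReyBellet2018_H2)`, which
implies `CuneoEckmannHairerReyBellet2018_lyapunov` (`…_lyapunov_of_H2` below).
[cite: CuneoEckmannHairerReyBellet2018, Thm 5.1 and Rem 5.2] -/
def CuneoEckmannHairerReyBellet2018_H2 : Prop :=
  ∀ ω₂ lam β γ : ℝ, 0 < ω₂ → 0 ≤ lam → 0 < β → 0 < γ →
    ∀ (N : ℕ) (T_L T_R : ℝ), 0 < N → 0 < T_L → 0 < T_R →
      ∀ θ : ℝ, 0 < θ → θ < 1 / max T_L T_R →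
        ∀ tstar : ℝ≥0, 0 < tstar →
          ∃ (κ c : ℝ) (K : Set (PhaseSpace N)), 0 < κ ∧ κ < 1 ∧ 0 < c ∧ IsCompact K ∧
            ∀ z : PhaseSpace N,
              ∫⁻ y, ENNReal.ofReal (Real.exp (θ * (pinnedChain ω₂ lam β γ).hamiltonian N y))
                  ∂((pinnedChain ω₂ lam β γ).transitionKernel N T_L T_R tstar z) ≤
                ENNReal.ofReal (κ * Real.exp (θ * (pinnedChain ω₂ lam β γ).hamiltonian N z) +
                  c * K.indicator 1 z)

/-- **`CuneoEckmannHairerReyBellet2018_lyapunov` from H2**: the transition semigroup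
`pinnedChainSemigroup` is the witness — it is Feller (`continuous_act_pinnedChainSemigroup`) and
satisfies (3.4) (`LangevinChainExpBound.lean`); H2 is the remaining named fact.
[cite: CuneoEckmannHairerReyBellet2018, Thm 5.1, Rem 5.2 and §3 eq. (3.4)] -/
theorem CuneoEckmannHairerReyBellet2018_lyapunov_of_H2 (h : CuneoEckmannHairerReyBellet2018_H2) :
    CuneoEckmannHairerReyBellet2018_lyapunov := by
  intro ω₂ lam β γ hω hl hβ hγ N T_L T_R hN hL hR
  refine ⟨pinnedChainSemigroup hω hl hβ.le hγ.le hN hL.le hR.le,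
    continuous_act_pinnedChainSemigroup hω hl hβ.le hγ.le hN hL.le hR.le, fun θ hθ hθ' => ⟨?_, ?_⟩⟩
  · intro t z
    exact lintegral_exp_mul_hamiltonian_pinnedChainSemigroup_le hω hl hβ.le hγ.le hN hL.le hR.le hL hR hθ hθ' t z
  · intro tstar htstar
    exact h ω₂ lam β γ hω hl hβ hγ N T_L T_R hN hL hR θ hθ hθ' tstar htstar

/-- **Theorem 2.13 (2) for the pinned chain from H2**: the transition semigroup has an invariant
probability measure integrating `e^{ϑH}` for all `0 < ϑ < 1/max(T_L,T_R)` (Krylov–Bogoliubov,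
`CuneoEckmannHairerReyBellet2018_lyapunov.exists_isInvariant`).
[cite: CuneoEckmannHairerReyBellet2018, Thm 2.13] -/
theorem CuneoEckmannHairerReyBellet2018_H2.lyapunov (h : CuneoEckmannHairerReyBellet2018_H2) :
    CuneoEckmannHairerReyBellet2018_lyapunov :=
  CuneoEckmannHairerReyBellet2018_lyapunov_of_H2 h

/-- **The weak-stationarity fact from H2 and Hörmander's theorem**: after this file the named fact
`CuneoEckmannHairerReyBellet2018_pinnedChain` rests on exactly CEHR Thm 5.1/Rem 5.2 (H2, for the
constructed semigroup) and Hörmander 1967 Thm 1.1.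
[cite: CuneoEckmannHairerReyBellet2018, Thm 2.13] -/
theorem CuneoEckmannHairerReyBellet2018_pinnedChain_of_H2_of_hormander (h : CuneoEckmannHairerReyBellet2018_H2)
    (hH : Literature.Analysis.Distribution.Hormander1967_thm11) : CuneoEckmannHairerReyBellet2018_pinnedChain :=
  CuneoEckmannHairerReyBellet2018_pinnedChain_of_lyapunov_of_hormander
    (CuneoEckmannHairerReyBellet2018_lyapunov_of_H2 h) hH

end Literature.MathematicalPhysics.KineticTheory.HeatConduction
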